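import Summits.ResolutionOfSingularities.ResolutionOfSingularities.Theorems.FrobeniusLadderFRationalResolutionWeaklyFRegularSurfaceLocal
import Summits.ResolutionOfSingularities.ResolutionOfSingularities.Theorems.FrobeniusLadderFRationalResolutionGorensteinGermIdentityModel
import Summits.ResolutionOfSingularities.ResolutionOfSingularities.Theorems.FrobeniusLadderFRationalResolutionFRationalSurfaceLocal
import Literature.AlgebraicGeometry.Resolution.CanonicalResolutionProofs
import HarnessLib

/-!
# Rungs 3½ and 4′ for surfaces from their one-germ forms

Support file for crux stmt-ResolutionOfSingularities-15317 (`FrobeniusLadder.FRationalResolution`),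
line `Sketch`, continuation seat c3, cycle 8 (closure of theme D2R, for the strategist's split
`X₁ ∧ X₂` of the crux, `fRationalResolution_iff_rungs`). In dimension 2 each rung is equivalent in
practice to a ONE-GERM statement:

* `weaklyFRegularModification_surfaces_of_G1` — RUNG 3½ (piece X₁) FOR SURFACES follows from (G1):
  every NON-GORENSTEIN F-rational surface germ has, on a neighbourhood with no other singular point,
  a proper weakly-F-regular local model which is an isomorphism over the regular locus with dense
  preimage. (The Gorenstein germs need nothing: `identity_local_model_of_socle_cyclic`, p156707;
  the local models glue: `weaklyFRegularModification_surface_of_local`, p155492.)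
* `weaklyFRegularResolution_surfaces_of_G2` — RUNG 4′ (piece X₂) FOR INTEGRAL SURFACES follows from
  (G2): every weakly-F-regular surface germ has such a neighbourhood with a local RESOLUTION
  (`hasResolution_fRational_surface_of_local`, p149439: the crux in dimension 2 is local).

[folklore assembly; cite: HochsterHuneke1994 (Gorenstein F-rational ⇒ F-regular); Lipman1969]
-/

-- single-problem summit: the doubled namespace component is forced
set_option linter.dupNamespace false

noncomputable section

namespace Summit.ResolutionOfSingularities.ResolutionOfSingularities.Theorems.FRationalResolution

open CategoryTheory AlgebraicGeometry TopologicalSpace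
open Literature.AlgebraicGeometry.Resolution

/-- **RUNG 3½ FOR SURFACES FROM (G1).** If every non-Gorenstein F-rational surface germ admits a
proper weakly-F-regular local model as in (G1), then every integral separated finite-type
F-rational SURFACE over a field of characteristic `p` has a proper birational model all of whose
stalks are domains with every ideal tightly closed (the conclusion of piece X₁ /
`WeaklyFRegularModification` in dimension 2). [folklore assembly] -/
theorem weaklyFRegularModification_surfaces_of_G1
    (hgerm₁ : ∀ (p : ℕ), p.Prime → ∀ (k : Type) [Field k] [CharP k p] (X : Scheme.{0})
      (f : X ⟶ Spec (.of k)) [IsSeparated f] [LocallyOfFiniteType f] [QuasiCompact f]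
      [IsIntegral X],
      (∀ x : X, IsDomain (X.presheaf.stalk x) ∧ ∀ d : ℕ, ringKrullDim (X.presheaf.stalk x) = d →
        ∀ s : Fin d → X.presheaf.stalk x, (Ideal.span (Set.range s)).radical.IsMaximal →
        ∀ y c : X.presheaf.stalk x, c ≠ 0 →
        (∀ e : ℕ, c * y ^ p ^ e ∈ Ideal.span ((fun z : X.presheaf.stalk x => z ^ p ^ e) ''
          (Ideal.span (Set.range s) : Set (X.presheaf.stalk x)))) → y ∈ Ideal.span (Set.range s)) →
      topologicalKrullDim X ≤ 2 →
      ∀ s : X, s ∉ Scheme.regularLocus X →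
      (¬ ∀ d : ℕ, ringKrullDim (X.presheaf.stalk s) = d → ∀ t : Fin d → X.presheaf.stalk s,
        (Ideal.span (Set.range t)).radical.IsMaximal →
        ∃ u : X.presheaf.stalk s, (Ideal.span (Set.range t)).colon
          (IsLocalRing.maximalIdeal (X.presheaf.stalk s) : Set (X.presheaf.stalk s)) =
          Ideal.span (Set.range t) ⊔ Ideal.span {u}) →
      ∃ (V : X.Opens), s ∈ V ∧ (∀ t : X, t ∉ Scheme.regularLocus X → t ∈ V → t = s) ∧
        ∃ (Y : Scheme.{0}) (ρ : Y ⟶ V), IsProper ρ ∧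
          (∀ y : Y, IsDomain (Y.presheaf.stalk y) ∧ ∀ I : Ideal (Y.presheaf.stalk y),
            ∀ a c : Y.presheaf.stalk y, c ≠ 0 →
            (∀ e : ℕ, c * a ^ p ^ e ∈ Ideal.span ((fun z : Y.presheaf.stalk y => z ^ p ^ e) ''
              (I : Set (Y.presheaf.stalk y)))) → a ∈ I) ∧
          IsIso (ρ ∣_ (V.ι ⁻¹ᵁ ⟨Scheme.regularLocus X,
            isOpen_regularLocus_of_locallyOfFiniteType_field f⟩)) ∧
          Dense ((ρ ⁻¹ᵁ (V.ι ⁻¹ᵁ ⟨Scheme.regularLocus X,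
            isOpen_regularLocus_of_locallyOfFiniteType_field f⟩) : Y.Opens) : Set Y))
    (p : ℕ) (hp : p.Prime) (k : Type) [Field k] [CharP k p] (X : Scheme.{0})
    (f : X ⟶ Spec (.of k)) [IsSeparated f] [LocallyOfFiniteType f] [QuasiCompact f] [IsIntegral X]
    (hFR : ∀ x : X, IsDomain (X.presheaf.stalk x) ∧ ∀ d : ℕ, ringKrullDim (X.presheaf.stalk x) = d →
        ∀ s : Fin d → X.presheaf.stalk x, (Ideal.span (Set.range s)).radical.IsMaximal →
        ∀ y c : X.presheaf.stalk x, c ≠ 0 →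
        (∀ e : ℕ, c * y ^ p ^ e ∈ Ideal.span ((fun z : X.presheaf.stalk x => z ^ p ^ e) ''
          (Ideal.span (Set.range s) : Set (X.presheaf.stalk x)))) → y ∈ Ideal.span (Set.range s))
    (hdim : topologicalKrullDim X ≤ 2) :
    ∃ (X' : Scheme.{0}) (π : X' ⟶ X), IsProper π ∧ IsBirational π ∧
      ∀ x : X', IsDomain (X'.presheaf.stalk x) ∧ ∀ I : Ideal (X'.presheaf.stalk x),
        ∀ y c : X'.presheaf.stalk x, c ≠ 0 →
        (∀ e : ℕ, c * y ^ p ^ e ∈ Ideal.span ((fun z : X'.presheaf.stalk x => z ^ p ^ e) ''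
          (I : Set (X'.presheaf.stalk x)))) → y ∈ I := by
  classical
  refine weaklyFRegularModification_surface_of_local p hp k X f hFR hdim fun s hs => ?_
  by_cases hsoc : ∀ d : ℕ, ringKrullDim (X.presheaf.stalk s) = d → ∀ t : Fin d → X.presheaf.stalk s,
        (Ideal.span (Set.range t)).radical.IsMaximal →
        ∃ u : X.presheaf.stalk s, (Ideal.span (Set.range t)).colon
          (IsLocalRing.maximalIdeal (X.presheaf.stalk s) : Set (X.presheaf.stalk s)) =
          Ideal.span (Set.range t) ⊔ Ideal.span {u}
  · exact identity_local_model_of_socle_cyclic p hp k X f hFR hdim s hs hsoc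
  · exact hgerm₁ p hp k X f hFR hdim s hs hsoc

/-- **RUNG 4′ FOR INTEGRAL SURFACES FROM (G2).** If every weakly-F-regular surface germ admits a
local resolution as in (G2), then every integral separated finite-type SURFACE over a field of
characteristic `p` whose stalks are domains with every ideal tightly closed has a resolution of
singularities (piece X₂ / rung 4′ in dimension 2, integral case). [folklore assembly] -/
theorem weaklyFRegularResolution_surfaces_of_G2
    (hgerm₂ : ∀ (p : ℕ), p.Prime → ∀ (k : Type) [Field k] [CharP k p] (X : Scheme.{0})
      (f : X ⟶ Spec (.of k)) [IsSeparated f] [LocallyOfFiniteType f] [QuasiCompact f]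
      [IsIntegral X],
      (∀ x : X, IsDomain (X.presheaf.stalk x) ∧ ∀ I : Ideal (X.presheaf.stalk x),
            ∀ a c : X.presheaf.stalk x, c ≠ 0 →
            (∀ e : ℕ, c * a ^ p ^ e ∈ Ideal.span ((fun z : X.presheaf.stalk x => z ^ p ^ e) ''
              (I : Set (X.presheaf.stalk x)))) → a ∈ I) →
      topologicalKrullDim X ≤ 2 →
      ∀ s : X, s ∉ Scheme.regularLocus X → ∃ (V : X.Opens), s ∈ V ∧
        (∀ t : X, t ∉ Scheme.regularLocus X → t ∈ V → t = s) ∧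
        ∃ (Y : Scheme.{0}) (ρ : Y ⟶ V), IsProper ρ ∧ Scheme.IsRegular Y ∧
          IsIso (ρ ∣_ (V.ι ⁻¹ᵁ ⟨Scheme.regularLocus X,
            isOpen_regularLocus_of_locallyOfFiniteType_field f⟩)) ∧
          Dense ((ρ ⁻¹ᵁ (V.ι ⁻¹ᵁ ⟨Scheme.regularLocus X,
            isOpen_regularLocus_of_locallyOfFiniteType_field f⟩) : Y.Opens) : Set Y))
    (p : ℕ) (hp : p.Prime) (k : Type) [Field k] [CharP k p] (X : Scheme.{0})
    (f : X ⟶ Spec (.of k)) [IsSeparated f] [LocallyOfFiniteType f] [QuasiCompact f] [IsIntegral X]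
    (hW : ∀ x : X, IsDomain (X.presheaf.stalk x) ∧ ∀ I : Ideal (X.presheaf.stalk x),
            ∀ a c : X.presheaf.stalk x, c ≠ 0 →
            (∀ e : ℕ, c * a ^ p ^ e ∈ Ideal.span ((fun z : X.presheaf.stalk x => z ^ p ^ e) ''
              (I : Set (X.presheaf.stalk x)))) → a ∈ I)
    (hdim : topologicalKrullDim X ≤ 2) :
    Scheme.HasResolution X :=
  hasResolution_fRational_surface_of_local p hp k X f
    (fun x => ⟨(hW x).1, fun _ _ s _ y c hc hy => (hW x).2 (Ideal.span (Set.range s)) y c hc hy⟩)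
    hdim (hgerm₂ p hp k X f hW hdim)

end Summit.ResolutionOfSingularities.ResolutionOfSingularities.Theorems.FRationalResolution

end
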